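/-
Copyright: H21 programme, solo seat `solo-RiemannHypothesis-informed` (session 5).
-/
import Summits.RiemannHypothesis.RiemannHypothesis.Theorems.SoloInformedNearCount

/-!
# The cluster test with its formula (solo-informed, T37 infrastructure)

`exists_clusterTest_gen` (`SoloInformedClusterFarDecay`) hides the cluster test behind an
existential.  The δ-free wall (T38) needs the phase lemma T37b, which is stated for the explicit
function `k = D₀ D_{clusterList γ₀ S'} h_c`; this file re-proves `exists_clusterTest_gen` with
the extra conjunct `k = weilDodges (0 :: clusterList γ₀ S') (bumpDipole ψ c)` (proof verbatim).
-/

open MeasureTheory Complex Set Filter Topology Literature.NumberTheory.LFunctions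
open scoped ContDiff ComplexConjugate

namespace Summit.RiemannHypothesis.RiemannHypothesis.Theorems

variable {ψ : ℝ → ℝ}

/-- **The cluster test, with its formula.**  `exists_clusterTest_gen` verbatim, recording in
addition that the witness is `k = D₀ D_{clusterList γ₀ S'} h_c`. -/
theorem exists_clusterTest_gen_eq (hψ : ContDiff ℝ ∞ ψ) (hsupp : tsupport ψ ⊆ Icc (-1) 1)
    (hψ0 : ∀ s, 0 ≤ ψ s) (N : ℕ) (R₀ : ℝ) (p : ℕ) {η γ₀ c δ : ℝ} {S' : Finset ℂ} (hη : 0 < η)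
    (hc : 0 ≤ c) (hδ : 0 < δ) (hδ1 : δ ≤ 1) (hcard : S'.card ≤ N)
    (hclus : ∀ ρ ∈ S', ‖ρ - (1 / 2 + γ₀ * I)‖ ≤ R₀ ∧ δ ≤ ‖ρ - (1 / 2 + η + γ₀ * I)‖ ∧
      δ ≤ ‖ρ - (1 / 2 - η + γ₀ * I)‖)
    (hgpos : 0 < Real.exp (η * c) * bumpLaplace ψ η - bumpLaplace ψ (-η)) :
    ∃ k : ℝ → ℂ, k = weilDodges (0 :: clusterList γ₀ S') (bumpDipole ψ c) ∧ IsWeilTest k ∧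
      (∀ t, k (-t) = -k t) ∧ tsupport k ⊆ Icc (-(c + 1)) (c + 1) ∧
      0 < ∫ t, ‖k t‖ ^ 2 ∧
      (∀ j ≤ p + 2,
        ∫ t, ‖iteratedDeriv j k t‖ ≤ 2 * ((1 + R₀ ^ 2) ^ N * bumpNormSum ψ (2 * N + 4 + p))) ∧
      η ^ 4 * δ ^ (4 * N) * (Real.exp (η * c) * bumpLaplace ψ η - bumpLaplace ψ (-η)) ^ 2 ≤
        ‖∫ t, k t * cexp ((η : ℂ) * t)‖ ^ 2 ∧
      (∀ ρ ∈ S', weilMellin (fun t ↦ k t * cexp (-(γ₀ * I) * t)) ρ = 0) := by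
  set B : ℝ := bumpNormSum ψ (2 * N + 4 + p) with hB_def
  have hB0 : 0 ≤ B := bumpNormSum_nonneg ψ _
  set Q : ℝ := (1 + R₀ ^ 2) ^ N * B with hQ_def
  -- the test `k = D_0 D_{clusterList} h_c`
  set L : List ℂ := clusterList γ₀ S' with hL_def
  set w : ℝ → ℂ := weilDodges L (bumpDipole ψ c) with hw_def
  set k : ℝ → ℂ := weilDodge 0 w with hk_def
  have hh : IsWeilTest (bumpDipole ψ c) := isWeilTest_bumpDipole hψ hsupp hc
  have hhodd : ∀ t, bumpDipole ψ c (-t) = -bumpDipole ψ c t := bumpDipole_odd ψ c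
  have hhs : tsupport (bumpDipole ψ c) ⊆ Icc (-(c + 1)) (c + 1) :=
    tsupport_bumpDipole_subset hsupp hc
  have hw : IsWeilTest w := isWeilTest_weilDodges hh L
  have hwodd : ∀ t, w (-t) = -w t := weilDodges_odd hhodd L
  have hk : IsWeilTest k := isWeilTest_weilDodge hw 0
  have hkodd : ∀ t, k (-t) = -k t := weilDodge_odd hwodd 0
  have hks : tsupport k ⊆ Icc (-(c + 1)) (c + 1) :=
    ((tsupport_weilDodge_subset 0 w).trans (tsupport_weilDodges_subset L _)).trans hhs
  have hk_eq : k = weilDodges (0 :: L) (bumpDipole ψ c) := rfl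
  -- the gain of the undodged dipole
  set g : ℝ := Real.exp (η * c) * bumpLaplace ψ η - bumpLaplace ψ (-η) with hg_def
  have hg0 : 0 ≤ g := hgpos.le
  have hgain : g ≤ ‖∫ t, bumpDipole ψ c t * cexp ((η : ℂ) * t)‖ :=
    gain_bumpDipole hψ.continuous hsupp hψ0 hη.le hc
  have hint_ne : ∫ t, bumpDipole ψ c t * cexp ((η : ℂ) * t) ≠ 0 := by
    intro h0
    rw [h0, norm_zero] at hgain
    linarith
  -- the cluster symbol at the pair
  set Pη : ℂ := ∏ ρ ∈ S', (ρ - (1 / 2 + η + γ₀ * I)) * (ρ - (1 / 2 - η + γ₀ * I)) with hPη_def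
  have hPη : δ ^ (2 * S'.card) ≤ ‖Pη‖ :=
    pow_le_norm_clusterSymbol S' hδ.le fun ρ hρ ↦ ⟨(hclus ρ hρ).2.1, (hclus ρ hρ).2.2⟩
  have hPηN : δ ^ (2 * N) ≤ ‖Pη‖ := (pow_le_pow_of_le_one hδ.le hδ1 (by omega)).trans hPη
  have hPη0 : 0 < ‖Pη‖ := lt_of_lt_of_le (by positivity) hPηN
  have e1 : ∀ f : ℝ → ℂ, ∫ t : ℝ, f t * cexp ((η : ℂ) * t) = weilMellin f (1 / 2 + η) := by
    intro f; unfold weilMellin; congr 1 with t; congr 2; ring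
  have hsymb : (L.map fun τ ↦ (-((1 : ℂ) / 2 + η - 1 / 2) ^ 2 - τ ^ 2)).prod = Pη := by
    rw [hPη_def, ← clusterSymbol_eq γ₀ S' η, hL_def]
    have e : (fun τ : ℂ ↦ (-((1 : ℂ) / 2 + η - 1 / 2) ^ 2 - τ ^ 2)) =
        fun τ ↦ (-(η : ℂ) ^ 2 - τ ^ 2) := by
      funext τ; ring
    rw [e]
  have hw_int : ∫ t, w t * cexp ((η : ℂ) * t) =
      Pη * ∫ t, bumpDipole ψ c t * cexp ((η : ℂ) * t) := by
    rw [e1, e1, hw_def, weilMellin_weilDodges hh L, hsymb]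
  have hw_ne : ∫ t, w t * cexp ((η : ℂ) * t) ≠ 0 := by
    rw [hw_int]; exact mul_ne_zero (norm_pos_iff.mp hPη0) hint_ne
  have hpos : 0 < ∫ t, ‖k t‖ ^ 2 := integral_norm_sq_weilDodge_zero_pos hw hη.ne' hw_ne
  have hnη : ‖(-((1 : ℂ) / 2 + η - 1 / 2) ^ 2 - (0 : ℂ) ^ 2)‖ = η ^ 2 := by
    have e : (-((1 : ℂ) / 2 + η - 1 / 2) ^ 2 - (0 : ℂ) ^ 2) = (((-(η ^ 2)) : ℝ) : ℂ) := by
      push_cast; ring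
    rw [e, Complex.norm_real, Real.norm_eq_abs, abs_neg, abs_of_nonneg (sq_nonneg η)]
  have hk_int : ‖∫ t, k t * cexp ((η : ℂ) * t)‖ ^ 2 =
      η ^ 4 * ‖Pη‖ ^ 2 * ‖∫ t, bumpDipole ψ c t * cexp ((η : ℂ) * t)‖ ^ 2 := by
    rw [e1 k, hk_def, weilMellin_weilDodge (contDiff_two_of_isWeilTest hw) hw.2, ← e1 w, hw_int,
      norm_mul, norm_mul, hnη]
    ring
  -- the list `0 :: L`: length and norm-inflation factor
  have hlen : (0 :: L).length = S'.card + 1 := by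
    rw [List.length_cons, hL_def, length_clusterList]
  have hprod : ((0 :: L).map fun τ ↦ 1 + ‖τ‖ ^ 2).prod ≤ (1 + R₀ ^ 2) ^ N := by
    rw [List.map_cons, List.prod_cons, norm_zero, hL_def]
    unfold clusterList
    rw [List.map_map, Finset.prod_map_toList]
    have e : ∏ ρ ∈ S', ((fun τ : ℂ ↦ 1 + ‖τ‖ ^ 2) ∘ clusterShift γ₀) ρ =
        ∏ ρ ∈ S', (1 + ‖ρ - (1 / 2 + γ₀ * I)‖ ^ 2) := by
      refine Finset.prod_congr rfl fun ρ _ ↦ ?_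
      simp only [Function.comp_apply, clusterShift, norm_mul, Complex.norm_I, one_mul]
      rw [show ρ - 1 / 2 - (γ₀ : ℂ) * I = ρ - (1 / 2 + γ₀ * I) by ring]
    rw [e]
    calc ((1 : ℝ) + 0 ^ 2) * ∏ ρ ∈ S', (1 + ‖ρ - (1 / 2 + γ₀ * I)‖ ^ 2)
        = ∏ ρ ∈ S', (1 + ‖ρ - (1 / 2 + γ₀ * I)‖ ^ 2) := by ring
      _ ≤ ∏ _ρ ∈ S', (1 + R₀ ^ 2) := by
          refine Finset.prod_le_prod (fun ρ _ ↦ by positivity) fun ρ hρ ↦ ?_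
          have h1 := (hclus ρ hρ).1
          nlinarith [norm_nonneg (ρ - (1 / 2 + γ₀ * I))]
      _ = (1 + R₀ ^ 2) ^ S'.card := Finset.prod_const _
      _ ≤ (1 + R₀ ^ 2) ^ N := pow_le_pow_right₀ (by nlinarith) hcard
  -- the `c`-independent norms of `k`
  have hnorm : ∀ j ≤ p + 2, ∫ t, ‖iteratedDeriv j k t‖ ≤ 2 * Q := by
    intro j hj
    have hjm : j + 2 * (0 :: L).length ≤ 2 * N + 4 + p := by rw [hlen]; omega
    calc ∫ t, ‖iteratedDeriv j k t‖
        = ∫ t, ‖iteratedDeriv j (weilDodges (0 :: L) (bumpDipole ψ c)) t‖ := by rw [hk_eq]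
      _ ≤ ((0 :: L).map fun τ ↦ 1 + ‖τ‖ ^ 2).prod * (2 * B) :=
          integral_norm_iteratedDeriv_weilDodges_bumpDipole_le hψ hsupp hc (2 * N + 4 + p) (0 :: L)
            hjm
      _ ≤ (1 + R₀ ^ 2) ^ N * (2 * B) := mul_le_mul_of_nonneg_right hprod (by positivity)
      _ = 2 * Q := by rw [hQ_def]; ring
  -- the gain of `k` dominates `η⁴ δ^{4N} g²`
  have hG : η ^ 4 * δ ^ (4 * N) * g ^ 2 ≤ ‖∫ t, k t * cexp ((η : ℂ) * t)‖ ^ 2 := by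
    rw [hk_int]
    have hP2 : δ ^ (4 * N) ≤ ‖Pη‖ ^ 2 := by
      rw [show 4 * N = 2 * N * 2 by ring, pow_mul]
      exact pow_le_pow_left₀ (by positivity) hPηN 2
    have hG2 : g ^ 2 ≤ ‖∫ t, bumpDipole ψ c t * cexp ((η : ℂ) * t)‖ ^ 2 :=
      pow_le_pow_left₀ hg0 hgain 2
    have hPG := mul_le_mul hP2 hG2 (sq_nonneg _) (sq_nonneg _)
    calc η ^ 4 * δ ^ (4 * N) * g ^ 2 = η ^ 4 * (δ ^ (4 * N) * g ^ 2) := by ring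
      _ ≤ η ^ 4 * (‖Pη‖ ^ 2 * ‖∫ t, bumpDipole ψ c t * cexp ((η : ℂ) * t)‖ ^ 2) :=
          mul_le_mul_of_nonneg_left hPG (by positivity)
      _ = η ^ 4 * ‖Pη‖ ^ 2 * ‖∫ t, bumpDipole ψ c t * cexp ((η : ℂ) * t)‖ ^ 2 := by ring
  -- the twisted transform of `k` vanishes on the cluster
  have hvan : ∀ ρ ∈ S', weilMellin (fun t ↦ k t * cexp (-(γ₀ * I) * t)) ρ = 0 := by
    intro ρ hρ
    rw [hk_eq, weilMellin_weilDodges_twist hh, List.map_cons, List.prod_cons]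
    have h0 := weilMellin_clusterDodges_twist_eq_zero hh γ₀ S' hρ
    rw [weilMellin_weilDodges_twist hh, ← hL_def] at h0
    rw [mul_assoc, h0, mul_zero]
  exact ⟨k, hk_eq, hk, hkodd, hks, hpos, hnorm, hG, hvan⟩

end Summit.RiemannHypothesis.RiemannHypothesis.Theorems
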